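import Summits.ABC.IUTFork.Thm311RealInd1StripTraceRigid
import Summits.ABC.IUTFork.Thm311RealInd1StripSignature
import Summits.ABC.IUTFork.Thm311RealInd2IsmUnitScalar
import HarnessLib

/-!
# [IUTchIII] Thm 3.11 (i) (Ind1)+(Ind2) at `v ∈ 𝕍^non`: the `p`-adic size of the TRACE is an invariant of the whole single-place
# indeterminacy group print names — `|Tr_{K_v/ℚ_p}(γ x)|_p = |Tr(x)|_p` for every `γ` generated by the (Ind1) strip part and (Ind2)

PROOF-ONLY file (abc-iut cell, Cor. 3.12 sub-crew, seat abc-iut-c312-1 = holder of record of the typed [IUTchIII] Thm. 3.11,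
gen 11; row «R13 TRACE-RIGIDITY», part b, on abc-iut-c312-5's carrier `Real.Carrier (inr v) = K_v`).  TAKES NO SIDE on
[IUTchIII] Cor. 3.12.

At a finite place `v` the two single-place indeterminacies of [IUTchIII] Thm. 3.11 (i) that this lineage typed print-literally are
`Real.ind1Strip logv v` (the (Ind1) STRIP part: automorphisms of `†𝒟⊢_v` through THE equivariant lift, gen 8) and `Real.ismIsm logv v`
(the (Ind2) part: [IUTchII] Ex. 1.8 (iv) isometries, gen 7), both read through the analytic logarithm `Real.analyticLogv F`.
* `Real.trace_apply_eq_of_mem_ind1Strip` — (Ind1) strip part: `Tr(ψ x) = Tr(x)` (part a, `Thm311RealInd1StripTraceRigid`: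
  Hoshi–Nishio 2022 Lemma 2.3 (ii) at the real log-shell; UNCONDITIONAL).
* `Real.norm_trace_apply_eq_of_mem_ismIsm` — (Ind2): `ψ` is a scalar `c ∈ ℤ_p^×` (abc-iut-w5-d216's
  `exists_unit_scalar_of_mem_ismIsm_analyticLogv`), so `|Tr(ψ x)|_p = |c·Tr(x)|_p = |Tr(x)|_p` (the trace itself is rescaled).
* **`Real.norm_trace_apply_eq_of_mem_closure_ind`** — for EVERY `γ` in the subgroup of `Aut_ℚ(K_v)` GENERATED by
  `Real.ind1Strip (analyticLogv F) v ∪ Real.ismIsm (analyticLogv F) v`: `|Tr_{K_v/ℚ_p}(γ x)|_p = |Tr(x)|_p` for all `x ∈ K_v`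
  (trace read in abc-iut-S7's rescaled completion).  Consequences (`…_trace_eq_zero_iff…`, `…image_traceSlab…`): the hyperplane
  `Ker Tr` and every trace slab `{x : |Tr x|_p ≤ r}` are carried ONTO themselves — whatever region inflation these indeterminacies
  effect at `v` (gen 10: index `≥ p` in every window of `e(v|p)+1` balls, modulo Jannsen–Wingberg) happens INSIDE the level sets
  of `|Tr|_p`; Dupuy–Hilado's `Aut_{ℚ_p}(K_v : I_v)` (c312-5 `Real.ismDH`) has no such invariant when `n_v ≥ 2`.
HONEST SCOPE: single-place statements about OUR typed objects (the packet-level group `LogShells.IndGroup` also permutes capsule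
indices, untouched here); unconditional; nothing here asserts or refutes [IUTchIII] Cor. 3.12.  [claim: Mochizuki2012, status: disputed];
[cite: HoshiNishio2022OuterAutMLF, Lemma 2.3 (ii) p.7]; [cite: DupuyHilado2025, §4.9].  typed ≠ proved.
-/

set_option autoImplicit false

noncomputable section

open Metric Set
open scoped Pointwise

namespace Summit.ABC.IUTFork.Thm311.Real

open NumberField IsDedekindDomain Literature.NumberTheory.NumberFields Literature.IUT.LogVolume
open Literature.NumberTheory.GaloisRepresentations Literature.NumberTheory.GaloisRepresentations.Ultrametric
open Literature.AnabelianGeometry.AbsoluteAnabelian Literature.IUT.HodgeArakelov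
open Literature.IUT.HodgeArakelov.AbsTopMonoids Literature.IUT.LogThetaLattice

variable {F : Type} [Field F] [NumberField F] (v : HeightOneSpectrum (𝓞 F)) [hp : Fact (closureAt v).residueChar.Prime]

/-- **(Ind1) strip part, on the carrier**: every `ψ ∈ Real.ind1Strip (analyticLogv F) v` preserves `Tr_{K_v/ℚ_{p_v}}`.
[claim: Mochizuki2012, status: disputed] [cite: HoshiNishio2022OuterAutMLF, Lemma 2.3 (ii) p.7] -/
theorem trace_apply_eq_of_mem_ind1Strip {ψ : Carrier (.inr v : Place F) ≃ₗ[ℚ] Carrier (.inr v : Place F)}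
    (hψ : ψ ∈ ind1Strip (analyticLogv F) v) (x : v.adicCompletion F) :
    Algebra.trace ℚ_[(closureAt v).residueChar]
        (RescaledCompletion F (closureAt v).residueChar v (natCast_residueChar_closureAt_mem v))
        (RescaledCompletion.of F (closureAt v).residueChar v (natCast_residueChar_closureAt_mem v) (ψ x)) =
      Algebra.trace ℚ_[(closureAt v).residueChar]
        (RescaledCompletion F (closureAt v).residueChar v (natCast_residueChar_closureAt_mem v))
        (RescaledCompletion.of F (closureAt v).residueChar v (natCast_residueChar_closureAt_mem v) x) :=
  trace_apply_eq_of_mem_ind1StripOf_analyticLogv v ((mem_ind1Strip_iff (analyticLogv F) v ψ).mp hψ) x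

/-- **(Ind2), on the carrier**: every `ψ ∈ Real.ismIsm (analyticLogv F) v` is a scalar `c ∈ ℤ_p^×`, hence preserves the `p`-adic
size of the trace: `|Tr(ψ x)|_p = |Tr(x)|_p`. [claim: Mochizuki2012, status: disputed] -/
theorem norm_trace_apply_eq_of_mem_ismIsm {ψ : Carrier (.inr v : Place F) ≃ₗ[ℚ] Carrier (.inr v : Place F)}
    (hψ : ψ ∈ ismIsm (analyticLogv F) v) (x : v.adicCompletion F) :
    ‖Algebra.trace ℚ_[(closureAt v).residueChar]
        (RescaledCompletion F (closureAt v).residueChar v (natCast_residueChar_closureAt_mem v))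
        (RescaledCompletion.of F (closureAt v).residueChar v (natCast_residueChar_closureAt_mem v) (ψ x))‖ =
      ‖Algebra.trace ℚ_[(closureAt v).residueChar]
        (RescaledCompletion F (closureAt v).residueChar v (natCast_residueChar_closureAt_mem v))
        (RescaledCompletion.of F (closureAt v).residueChar v (natCast_residueChar_closureAt_mem v) x)‖ := by
  obtain ⟨c, hc1, hc⟩ :=
    exists_unit_scalar_of_mem_ismIsm_analyticLogv (closureAt v).residueChar v (natCast_residueChar_closureAt_mem v) hψ
  rw [hc x, map_smul, smul_eq_mul, norm_mul, hc1, one_mul]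

/-- **THE `p`-ADIC SIZE OF THE TRACE IS AN INVARIANT OF THE SINGLE-PLACE INDETERMINACY GROUP PRINT NAMES AT `v`.**  For every `γ` in
the subgroup of `Aut_ℚ(K_v)` generated by the (Ind1) strip part `Real.ind1Strip (analyticLogv F) v` and the (Ind2) part
`Real.ismIsm (analyticLogv F) v`, and every `x ∈ K_v`: `|Tr_{K_v/ℚ_{p_v}}(γ x)|_p = |Tr(x)|_p` (trace read in `K_v^{(1/n_v)}`).
Generators: `trace_apply_eq_of_mem_ind1Strip`, `norm_trace_apply_eq_of_mem_ismIsm`; closure: the invariant composes and inverts.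
[claim: Mochizuki2012, status: disputed] [cite: HoshiNishio2022OuterAutMLF, Lemma 2.3 (ii) p.7] -/
theorem norm_trace_apply_eq_of_mem_closure_ind {γ : Carrier (.inr v : Place F) ≃ₗ[ℚ] Carrier (.inr v : Place F)}
    (hγ : γ ∈ Subgroup.closure (ind1Strip (analyticLogv F) v ∪ ismIsm (analyticLogv F) v)) (x : v.adicCompletion F) :
    ‖Algebra.trace ℚ_[(closureAt v).residueChar]
        (RescaledCompletion F (closureAt v).residueChar v (natCast_residueChar_closureAt_mem v))
        (RescaledCompletion.of F (closureAt v).residueChar v (natCast_residueChar_closureAt_mem v) (γ x))‖ =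
      ‖Algebra.trace ℚ_[(closureAt v).residueChar]
        (RescaledCompletion F (closureAt v).residueChar v (natCast_residueChar_closureAt_mem v))
        (RescaledCompletion.of F (closureAt v).residueChar v (natCast_residueChar_closureAt_mem v) x)‖ := by
  induction hγ using Subgroup.closure_induction generalizing x with
  | mem δ hδ =>
    rcases hδ with h | h
    · rw [trace_apply_eq_of_mem_ind1Strip v h x]
    · exact norm_trace_apply_eq_of_mem_ismIsm v h x
  | one => rfl
  | mul δ₁ δ₂ _ _ h₁ h₂ => rw [LinearEquiv.mul_apply, h₁, h₂]
  | inv δ _ h =>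
    have h' := h (δ⁻¹ x)
    rw [show δ (δ⁻¹ x) = x from δ.apply_symm_apply x] at h'
    exact h'.symm

/-- **`Ker(Tr)` is carried onto itself** by every `γ` of the single-place indeterminacy group: `Tr(γ x) = 0 ↔ Tr(x) = 0`.
[claim: Mochizuki2012, status: disputed] [cite: HoshiNishio2022OuterAutMLF, Lemma 2.3 (ii) p.7] -/
theorem trace_apply_eq_zero_iff_of_mem_closure_ind {γ : Carrier (.inr v : Place F) ≃ₗ[ℚ] Carrier (.inr v : Place F)}
    (hγ : γ ∈ Subgroup.closure (ind1Strip (analyticLogv F) v ∪ ismIsm (analyticLogv F) v)) (x : v.adicCompletion F) :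
    Algebra.trace ℚ_[(closureAt v).residueChar]
        (RescaledCompletion F (closureAt v).residueChar v (natCast_residueChar_closureAt_mem v))
        (RescaledCompletion.of F (closureAt v).residueChar v (natCast_residueChar_closureAt_mem v) (γ x)) = 0 ↔
      Algebra.trace ℚ_[(closureAt v).residueChar]
        (RescaledCompletion F (closureAt v).residueChar v (natCast_residueChar_closureAt_mem v))
        (RescaledCompletion.of F (closureAt v).residueChar v (natCast_residueChar_closureAt_mem v) x) = 0 := by
  rw [← norm_eq_zero, norm_trace_apply_eq_of_mem_closure_ind v hγ x, norm_eq_zero]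

/-- **Every trace slab `{x : |Tr(x)|_p ≤ r}` is carried ONTO itself** by every `γ` of the single-place indeterminacy group generated
by print's (Ind1) strip part and (Ind2) at `v` — no inflation across the level sets of `|Tr|_p`.
[claim: Mochizuki2012, status: disputed] [cite: HoshiNishio2022OuterAutMLF, Lemma 2.3 (ii) p.7] -/
theorem image_traceSlab_eq_of_mem_closure_ind {γ : Carrier (.inr v : Place F) ≃ₗ[ℚ] Carrier (.inr v : Place F)}
    (hγ : γ ∈ Subgroup.closure (ind1Strip (analyticLogv F) v ∪ ismIsm (analyticLogv F) v)) (r : ℝ) :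
    (fun x => γ x) ''
        {x : Carrier (.inr v : Place F) |
          ‖Algebra.trace ℚ_[(closureAt v).residueChar]
              (RescaledCompletion F (closureAt v).residueChar v (natCast_residueChar_closureAt_mem v))
              (RescaledCompletion.of F (closureAt v).residueChar v (natCast_residueChar_closureAt_mem v) x)‖ ≤ r} =
      {x : Carrier (.inr v : Place F) |
        ‖Algebra.trace ℚ_[(closureAt v).residueChar]
            (RescaledCompletion F (closureAt v).residueChar v (natCast_residueChar_closureAt_mem v))
            (RescaledCompletion.of F (closureAt v).residueChar v (natCast_residueChar_closureAt_mem v) x)‖ ≤ r} := by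
  ext y
  simp only [Set.mem_image, Set.mem_setOf_eq]
  constructor
  · rintro ⟨x, hx, rfl⟩
    rwa [norm_trace_apply_eq_of_mem_closure_ind v hγ x]
  · intro hy
    refine ⟨γ⁻¹ y, ?_, ?_⟩
    · rwa [norm_trace_apply_eq_of_mem_closure_ind v (Subgroup.inv_mem _ hγ) y]
    · exact γ.apply_symm_apply y

end Summit.ABC.IUTFork.Thm311.Real

end
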